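import Literature.AlgebraicGeometry.AbelianSchemes.SerreTensorRecognition
import Literature.AlgebraicGeometry.AbelianSchemes.SerreTensorIdealTranslationQuasiInverse
import Literature.AlgebraicGeometry.AbelianSchemes.DualIsogenyQuasiInverse
import Literature.AlgebraicGeometry.AbelianSchemes.AbelianSchemeHomDescentPolarized
import Literature.AlgebraicGeometry.AbelianSchemes.IsLambdaOfAtPullbackWitness
import Literature.AlgebraicGeometry.AbelianSchemes.AbelianSchemeQuotientPolarizationExistsAmple
import Literature.AlgebraicGeometry.AbelianSchemes.DualIsogenyMulN
import HarnessLib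

/-!
# The Serre twist of a POLARIZED family: `(A ⊗_𝒪 𝔟, λ_𝔟)` — the pull-back normalisation and the exact normalisation
# ([RapoportSmithlingZhang2020Diagonal] §3.2 ∕ (4.23); [MumfordAV1970] §23; B. Conrad, *Gross–Zagier revisited* §7)

Layer `Literature/AlgebraicGeometry/AbelianSchemes`, namespace `Literature.AlgebraicGeometry.AbelianSchemes.AbelianSchemeOver`.  THREE definitions
with body (`serreTwistLamPull`, `serreTwistPolPull`, `IsExactTwistPol`) + theorems; no instance, no notation, no named fact, no `sorry`.  Cell
`hodgecm-mathlib` (D-0151), programme P6 «MOD», desk F0P6a-plan (g1) ORGAN DEALS #1 **(O-γ) «SERRE TWIST OF A PEL FAMILY»**, part (γ2) = the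
POLARIZATION (A-p06 (g30) lead hand; twins A-p01 (g24), F0P6-p16 (g0)).  Count-neutral: HC_CM is proved only modulo the printed citations until
rung 0 closes; nothing here bears on it.

## Mathematics

Let `A → S` be a commutative abelian scheme with a ring action `ι : 𝒪 → End(A)` (★ `RingAction`), `𝔟 = E′·𝒪ᵐ` a presented finite projective
`𝒪`-module with an element `P ∈ 𝔟` (`E′P = P`) and a quasi-inverse row `Q` (`QE′ = Q`, `QP = N`, `PQ = N·E′`, `N ≥ 1`) — the model case being
`𝔟 = 𝔞⁻¹ ∋ 1 ↔ P` for an invertible ideal `𝔞 ∋ N` ([Conrad2004GrossZagier] §7).  The tree has the Serre tensor `A ⊗_𝒪 𝔟` (★ `serreTensor`) with its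
`𝒪`-action (★ `serreAction`) and the two canonical isogenies ★ `ψ_P := serreTranslate : A → A ⊗ 𝔟` («`A → A ⊗ 𝔞⁻¹`», kernel `A[𝔞]`) and ★
`ψ′ := serreTranslateInv : A ⊗ 𝔟 → A` with `ψ_P ψ′ = [N]`, `ψ′ ψ_P = [N]` (★ p845429).  Given a dual pair `D = (Â, 𝒫)` of `A`, a dual pair
`D𝔟` of `A ⊗ 𝔟` (ANY — unique up to ★ `hatTransportIso`; its existence is not asserted here) with the unit hypotheses, and a polarization
`λ : A → Â` (★ `Polarization`):

* §1 (the PULL-BACK normalisation, always defined) **`λ_𝔟^{pull} := ψ′ ≫ λ ≫ ψ′^∨ : A ⊗ 𝔟 → (A ⊗ 𝔟)^∧`** (`serreTwistLamPull`), a homomorphism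
  over a reduced locally Noetherian base, and a POLARIZATION (`serreTwistPolPull`): at a geometric point an ample witness `Θ` of `λ̄` pulls back
  along the finite `ψ′_s` to an ample witness of `λ̄_𝔟^{pull}` (★ `exists_isAmple_isLambdaOfAt_of_comp_dualIsogeny_eq`, [MumfordAV1970] §23 Thm. 2).
* §2 (the EXACT normalisation, RSZ's) for a scalar `c : ℕ`: **`IsExactTwistPol c λ′ :⟺ ψ_P ≫ λ′ ≫ ψ_P^∨ = λ ≫ [c]_{Â}`** («`ψ_P^*λ′ = c·λ`»,
  the similitude shape of ★ (DF-2) `F ≫ λ^{(q)} ≫ F^∨ = λ ≫ [q]` — so under ★ `A ⊗ 𝔞⁻¹ ≅ A^{(q)}` the Frobenius-twisted polarization is exact with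
  `c = q`, ★ `transport_eq_of_serreTranslate_pullback_eq`).  **UNIQUENESS** `IsExactTwistPol.eq`: two exact `λ′` coincide (cancel the fppf cover
  `ψ_P` on the left, ★ `cancel_left_of_flat_surjective`, and the quasi-invertible `ψ_P^∨` on the right, ★ `cancel_right_of_comp_eq_pow_id` with
  ★ `dualIsogenyOver_serreTranslate_comp_eq_pow_id`).  EXISTENCE is NOT proved here (it is the descent of `c·λ` along `ψ_P`, whose kernel `A[𝔞]`
  is `e^{cλ}`-isotropic when `c ∈ 𝔞𝔞̄`; ★ `polarizationDesc` covers the constant-kernel case).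
* §3 the two normalisations compared: **`isExactTwistPol_serreTwistLamPull : IsExactTwistPol (N^2) λ_𝔟^{pull}`** (`ψ_P ψ′ = [N]` twice, `[N]^∨ = [N]`),
  and **`serreTwistLamPull_eq_of_isExactTwistPol : IsExactTwistPol c λ′ → c·k = N² → λ_𝔟^{pull} = λ′ ≫ [k]`** — the pull-back normalisation
  is `N² ∕ c` times the exact one (in the CM case `𝔞𝔞̄ = (c)`, `N ∈ 𝔞`).

## References
* [RapoportSmithlingZhang2020Diagonal] M. Rapoport, B. Smithling, W. Zhang, *Arithmetic diagonal cycles on unitary Shimura varieties* (2020), §3.2, (4.23).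
* [MumfordAV1970] D. Mumford, *Abelian Varieties* (1970), §23 (Thm. 2, p. 231), §15 Thm. 1 (p. 143).
* [Conrad2004GrossZagier] B. Conrad, *Gross–Zagier revisited*, MSRI Publ. 49 (2004), §7 (Thm. 7.5).
* [MumfordFogartyKirwan1994] D. Mumford, J. Fogarty, F. Kirwan, *Geometric Invariant Theory*, 3rd ed. (1994), Ch. 6 §2 Definition 6.3 (p. 120).
-/

noncomputable section

universe u

open CategoryTheory CategoryTheory.Limits AlgebraicGeometry MonoidalCategory CartesianMonoidalCategory
open scoped MonObj

-- `Scheme.Modules` / `SheafOfModules` are not reducible (as in the ★ `AbelianSchemeDualPair*` files).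
set_option backward.isDefEq.respectTransparency false

namespace Literature.AlgebraicGeometry.AbelianSchemes

namespace AbelianSchemeOver

variable {S : Scheme.{u}} {A : AbelianSchemeOver S} {O : Type*} [CommRing O] (act : A.RingAction O) [IsCommMonObj A.X]
  {m : ℕ} (E' : Matrix (Fin m) (Fin m) O) (hE' : E' * E' = E') (P : Matrix (Fin m) (Fin 1) O) (Q : Matrix (Fin 1) (Fin m) O) {N : ℕ}
  (D : A.DualPair) (Db : (serreTensor act E' hE').DualPair)
  (hD : Nonempty ((Scheme.Modules.pullback (DualPair.unitHatSlice D)).obj D.P ≅ SheafOfModules.unit _))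
  (hDb : Nonempty ((Scheme.Modules.pullback (DualPair.unitHatSlice Db)).obj Db.P ≅ SheafOfModules.unit _))
  (pol : A.Polarization D)

/-! ## §1 The pull-back normalisation `λ_𝔟^{pull} = ψ′ ≫ λ ≫ ψ′^∨` — always a polarization -/

/-- **`λ_𝔟^{pull} := ψ′ ≫ λ ≫ ψ′^∨ : A ⊗ 𝔟 → (A ⊗ 𝔟)^∧`**, the pull-back of the polarization `λ` along the canonical isogeny
`ψ′ = serreTranslateInv : A ⊗ 𝔟 → A` (★ p845429), with `ψ′^∨` the dual homomorphism for the dual pairs `D𝔟`, `D` (★ `dualIsogenyOver`).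
[cite: MumfordAV1970, §23 (Thm. 2, p. 231)] [cite: MumfordFogartyKirwan1994, Ch. 6 §2 Definition 6.3 (p. 120)] -/
def serreTwistLamPull : (serreTensor act E' hE').X ⟶ Db.hat.X :=
  haveI := isMonHom_serreTranslateInv act E' hE' Q
  serreTranslateInv act E' hE' Q ≫ pol.lam ≫ DualPair.dualIsogenyOver (serreTranslateInv act E' hE' Q) Db D

/-- Unfolding `λ_𝔟^{pull}`. [cite: MumfordAV1970, §23 (Thm. 2, p. 231)] -/
theorem serreTwistLamPull_def :
    haveI := isMonHom_serreTranslateInv act E' hE' Q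
    serreTwistLamPull act E' hE' Q D Db pol =
      serreTranslateInv act E' hE' Q ≫ pol.lam ≫ DualPair.dualIsogenyOver (serreTranslateInv act E' hE' Q) Db D :=
  rfl

include hD hDb in
/-- `λ_𝔟^{pull}` is a homomorphism (over a reduced locally Noetherian base, where `ψ′^∨` is one, ★ `isMonHom_dualIsogenyOver`).
[cite: MumfordFogartyKirwan1994, Ch. 6 §1 Corollary 6.4 (p. 117)] -/
theorem isMonHom_serreTwistLamPull [IsReduced S] [IsLocallyNoetherian S] : IsMonHom (serreTwistLamPull act E' hE' Q D Db pol) := by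
  haveI := isMonHom_serreTranslateInv act E' hE' Q
  haveI := pol.isMonHom
  haveI := DualPair.isMonHom_dualIsogenyOver (serreTranslateInv act E' hE' Q) Db D hD hDb
  rw [serreTwistLamPull_def]
  infer_instance

/-- **`(A ⊗ 𝔟, λ_𝔟^{pull})` IS A POLARIZED ABELIAN SCHEME.**  Over a reduced locally Noetherian base, with the quasi-inverse data
`E′P = P`, `QE′ = Q`, `PQ = N·E′`, `N ≠ 0` (so that `ψ′ ≫ ψ_P = [N]` and `ψ′_s` is finite): `λ_𝔟^{pull}` is a polarization of `A ⊗ 𝔟` for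
the dual pair `D𝔟` — at every geometric point an ample `Θ` with `λ̄ = Λ(𝒪(Θ))` pulls back along `ψ′_s` to an ample witness of `λ̄_𝔟^{pull}` (★
`exists_isAmple_isLambdaOfAt_of_comp_dualIsogeny_eq`, ★ `isAffineHom_toSchemeHom_fibreHom_of_comp_eq_mulN`).
[cite: MumfordAV1970, §23 (Thm. 2, p. 231)] [cite: MumfordFogartyKirwan1994, Ch. 6 §2 Definition 6.3 (p. 120)] -/
def serreTwistPolPull [IsReduced S] [IsLocallyNoetherian S] (hN : N ≠ 0) (hP : E' * P = P) (hQ : Q * E' = Q)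
    (hQP : Q * P = Matrix.scalar (Fin 1) (N : O)) (hPQ : P * Q = Matrix.scalar (Fin m) (N : O) * E') :
    (serreTensor act E' hE').Polarization Db where
  lam := serreTwistLamPull act E' hE' Q D Db pol
  isMonHom := isMonHom_serreTwistLamPull act E' hE' Q D Db hD hDb pol
  exists_ample Ω _ _ s := by
    haveI := isMonHom_serreTranslateInv act E' hE' Q
    haveI := isMonHom_serreTranslate act E' hE' P
    haveI := pol.isMonHom
    obtain ⟨Θ, hΘa, hΘ⟩ := pol.exists_ample Ω s
    haveI := isAffineHom_toSchemeHom_fibreHom_of_comp_eq_mulN (serreTranslateInv act E' hE' Q) (serreTranslate act E' hE' P) s hN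
      (serreTranslateInv_comp_serreTranslate act E' hE' P Q hP hQ hPQ)
    haveI : IsDominant (Motives.AbelianVariety.Hom.toSchemeHom (fibreHom (serreTranslateInv act E' hE' Q) s)) :=
      ⟨(isIsogeny_fibreHom_of_quasiInverse (serreTranslateInv act E' hE' Q) (serreTranslate act E' hE' P) hN
        (serreTranslateInv_comp_serreTranslate act E' hE' P Q hP hQ hPQ) (serreTranslate_comp_serreTranslateInv act E' hE' P Q hP hQ hQP)
        s).1.1.denseRange⟩
    exact exists_isAmple_isLambdaOfAt_of_comp_dualIsogeny_eq (serreTranslateInv act E' hE' Q) Db D s pol.lam rfl hΘa hΘ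

/-- The polarization morphism of `serreTwistPolPull` IS `λ_𝔟^{pull}`. [cite: MumfordAV1970, §23 (Thm. 2, p. 231)] -/
theorem serreTwistPolPull_lam [IsReduced S] [IsLocallyNoetherian S] (hN : N ≠ 0) (hP : E' * P = P) (hQ : Q * E' = Q)
    (hQP : Q * P = Matrix.scalar (Fin 1) (N : O)) (hPQ : P * Q = Matrix.scalar (Fin m) (N : O) * E') :
    (serreTwistPolPull act E' hE' P Q D Db hD hDb pol hN hP hQ hQP hPQ).lam = serreTwistLamPull act E' hE' Q D Db pol :=
  rfl

/-! ## §2 The exact normalisation `ψ_P ≫ λ′ ≫ ψ_P^∨ = λ ≫ [c]` and its uniqueness -/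

/-- **`IsExactTwistPol c λ′`: the polarization `λ′` of `A ⊗ 𝔟` is EXACT with similitude scalar `c`** — `ψ_P ≫ λ′ ≫ ψ_P^∨ = λ ≫ [c]_{Â}`, i.e.
`ψ_P^*λ′ = c·λ` (RSZ: the `λ`-exact Serre transport along the quasi-isogeny `c^{-1∕2}ψ_P`; for `𝔟 = 𝔞⁻¹`, `c` generates `𝔞𝔞̄`).
[cite: RapoportSmithlingZhang2020Diagonal, §3.2 and (4.23)] [cite: MumfordAV1970, §23 (Thm. 2, p. 231)] -/
def IsExactTwistPol (c : ℕ) (lam' : (serreTensor act E' hE').X ⟶ Db.hat.X) : Prop :=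
  haveI := isMonHom_serreTranslate act E' hE' P
  serreTranslate act E' hE' P ≫ lam' ≫ DualPair.dualIsogenyOver (serreTranslate act E' hE' P) D Db = pol.lam ≫ D.hat.mulN c

/-- Unfolding `IsExactTwistPol`. [cite: RapoportSmithlingZhang2020Diagonal, §3.2 and (4.23)] -/
theorem isExactTwistPol_iff (c : ℕ) (lam' : (serreTensor act E' hE').X ⟶ Db.hat.X) :
    haveI := isMonHom_serreTranslate act E' hE' P
    IsExactTwistPol act E' hE' P D Db pol c lam' ↔
      serreTranslate act E' hE' P ≫ lam' ≫ DualPair.dualIsogenyOver (serreTranslate act E' hE' P) D Db = pol.lam ≫ D.hat.mulN c :=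
  Iff.rfl

include hDb in
/-- **UNIQUENESS OF THE EXACT TWISTED POLARIZATION**: two homomorphisms `λ₁′, λ₂′ : A ⊗ 𝔟 → (A ⊗ 𝔟)^∧` with `ψ_P ≫ λᵢ′ ≫ ψ_P^∨ = λ ≫ [c]` are
EQUAL — cancel the fppf cover `ψ_P` on the left (★ `cancel_left_of_flat_surjective`) and the quasi-invertible `ψ_P^∨` on the right
(`ψ_P^∨ ≫ ψ′^∨ = [N]`, ★ `dualIsogenyOver_serreTranslate_comp_eq_pow_id`; ★ `cancel_right_of_comp_eq_pow_id`).
[cite: RapoportSmithlingZhang2020Diagonal, §3.2 and (4.23)] [cite: MumfordAV1970, §23 (Thm. 2, p. 231)] -/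
theorem IsExactTwistPol.eq [IsReduced S] [IsLocallyNoetherian S] (hN : N ≠ 0) (hP : E' * P = P) (hQ : Q * E' = Q)
    (hQP : Q * P = Matrix.scalar (Fin 1) (N : O)) (hPQ : P * Q = Matrix.scalar (Fin m) (N : O) * E') {c : ℕ}
    {lam₁ lam₂ : (serreTensor act E' hE').X ⟶ Db.hat.X} [IsMonHom lam₁] [IsMonHom lam₂]
    (h₁ : IsExactTwistPol act E' hE' P D Db pol c lam₁) (h₂ : IsExactTwistPol act E' hE' P D Db pol c lam₂) : lam₁ = lam₂ := by
  haveI := isMonHom_serreTranslate act E' hE' P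
  haveI := isMonHom_serreTranslateInv act E' hE' Q
  haveI := flat_serreTranslate_left act E' hE' P Q hN hP hQ hQP hPQ
  haveI := surjective_serreTranslate_left act E' hE' P Q hN hP hQ hQP hPQ
  haveI := quasiCompact_serreTranslate_left act E' hE' P Q hN hP hQ hQP hPQ
  rw [isExactTwistPol_iff] at h₁ h₂
  -- cancel `ψ_P` on the left
  have h12 : lam₁ ≫ DualPair.dualIsogenyOver (serreTranslate act E' hE' P) D Db =
      lam₂ ≫ DualPair.dualIsogenyOver (serreTranslate act E' hE' P) D Db :=
    cancel_left_of_flat_surjective A (serreTranslate act E' hE' P) (h₁.trans h₂.symm)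
  -- cancel the quasi-invertible `ψ_P^∨` on the right
  exact cancel_right_of_comp_eq_pow_id (serreTensor act E' hE')
    (DualPair.dualIsogenyOver (serreTranslate act E' hE' P) D Db) (DualPair.dualIsogenyOver (serreTranslateInv act E' hE' Q) Db D) hN
    (dualIsogenyOver_serreTranslate_comp_eq_pow_id act E' hE' P Q hP hQ hPQ D Db hDb) lam₁ lam₂ h12

/-! ## §3 The two normalisations compared: `λ_𝔟^{pull}` is exact with scalar `N²` -/

include hD in
/-- **`ψ_P ≫ λ_𝔟^{pull} ≫ ψ_P^∨ = λ ≫ [N²]`** — the pull-back normalisation is exact with similitude scalar `N²`: `ψ_P ≫ ψ′ = [N]_A` (★),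
`ψ′^∨ ≫ ψ_P^∨ = (ψ_P ≫ ψ′)^∨ = [N]^∨ = [N]_{Â}` (★ `dualIsogenyOver_comp`, ★ `dualIsogenyOver_mulN`), and `[N]` commutes past the homomorphism
`λ`. [cite: MumfordAV1970, §23 (Thm. 2, p. 231) and §15 Thm. 1 (p. 143)] -/
theorem isExactTwistPol_serreTwistLamPull [IsReduced S] [IsLocallyNoetherian S] (hP : E' * P = P) (hQ : Q * E' = Q)
    (hQP : Q * P = Matrix.scalar (Fin 1) (N : O)) :
    IsExactTwistPol act E' hE' P D Db pol (N ^ 2) (serreTwistLamPull act E' hE' Q D Db pol) := by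
  haveI := isMonHom_serreTranslate act E' hE' P
  haveI := isMonHom_serreTranslateInv act E' hE' Q
  haveI := pol.isMonHom
  haveI : IsCommMonObj D.hat.X := D.hat.isCommMonObj_of_isReduced_base
  haveI : IsMonHom (A.mulN N) := A.isMonHom_mulN N
  have hψ : serreTranslate act E' hE' P ≫ serreTranslateInv act E' hE' Q = A.mulN N :=
    serreTranslate_comp_serreTranslateInv act E' hE' P Q hP hQ hQP
  -- `ψ′^∨ ≫ ψ_P^∨ = (ψ_P ≫ ψ′)^∨ = [N]^∨ = [N]`
  have hdual : DualPair.dualIsogenyOver (serreTranslateInv act E' hE' Q) Db D ≫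
      DualPair.dualIsogenyOver (serreTranslate act E' hE' P) D Db = D.hat.mulN N := by
    rw [← DualPair.dualIsogenyOver_comp (serreTranslate act E' hE' P) (serreTranslateInv act E' hE' Q) D Db D,
      DualPair.dualIsogenyOver_congr D D (h₂ := A.isMonHom_mulN N) hψ, D.dualIsogenyOver_mulN hD N]
  rw [isExactTwistPol_iff, serreTwistLamPull_def, Category.assoc, Category.assoc, hdual, ← Category.assoc, hψ]
  -- `[N] ≫ λ ≫ [N] = λ ≫ [N²]`
  have h1 : A.mulN N ≫ pol.lam = pol.lam ^ N := by rw [mulN_def, MonObj.pow_comp, Category.id_comp]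
  have h2 : (pol.lam ^ N) ≫ D.hat.mulN N = pol.lam ^ (N * N) := by rw [mulN_def, MonObj.comp_pow, Category.comp_id, ← pow_mul]
  have h3 : pol.lam ≫ D.hat.mulN (N ^ 2) = pol.lam ^ (N ^ 2) := by rw [mulN_def, MonObj.comp_pow, Category.comp_id]
  rw [← Category.assoc, h1, h2, h3, sq]

include hD hDb in
/-- **The pull-back normalisation is `N² ∕ c` times the exact one**: if `λ′` is exact with scalar `c` and `c · k = N²`, then
`λ_𝔟^{pull} = λ′ ≫ [k]_{(A ⊗ 𝔟)^∧}` (both are exact with scalar `N²`; uniqueness §2).  In the CM case `𝔞𝔞̄ = (c)`, `N ∈ 𝔞 ∩ ℤ`.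
[cite: RapoportSmithlingZhang2020Diagonal, §3.2 and (4.23)] [cite: MumfordAV1970, §23 (Thm. 2, p. 231)] -/
theorem serreTwistLamPull_eq_of_isExactTwistPol [IsReduced S] [IsLocallyNoetherian S] (hN : N ≠ 0) (hP : E' * P = P)
    (hQ : Q * E' = Q) (hQP : Q * P = Matrix.scalar (Fin 1) (N : O)) (hPQ : P * Q = Matrix.scalar (Fin m) (N : O) * E') {c k : ℕ}
    (hck : c * k = N ^ 2) {lam' : (serreTensor act E' hE').X ⟶ Db.hat.X} [IsMonHom lam'] (h : IsExactTwistPol act E' hE' P D Db pol c lam') :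
    serreTwistLamPull act E' hE' Q D Db pol = lam' ≫ Db.hat.mulN k := by
  haveI := isMonHom_serreTranslate act E' hE' P
  haveI := isMonHom_serreTwistLamPull act E' hE' Q D Db hD hDb pol
  haveI : IsCommMonObj Db.hat.X := Db.hat.isCommMonObj_of_isReduced_base
  haveI : IsMonHom (Db.hat.mulN k) := Db.hat.isMonHom_mulN k
  haveI : IsMonHom (DualPair.dualIsogenyOver (serreTranslate act E' hE' P) D Db) :=
    DualPair.isMonHom_dualIsogenyOver (serreTranslate act E' hE' P) D Db hDb hD
  refine IsExactTwistPol.eq act E' hE' P Q D Db hDb pol hN hP hQ hQP hPQ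
    (isExactTwistPol_serreTwistLamPull act E' hE' P Q D Db hD pol hP hQ hQP) ?_
  -- `λ′ ≫ [k]` is exact with scalar `c · k = N²`
  rw [isExactTwistPol_iff] at h ⊢
  -- `ψ ≫ (λ′ ≫ [k]) ≫ ψ^∨ = (ψ ≫ λ′ ≫ ψ^∨) ≫ [k] = λ ≫ [c] ≫ [k] = λ ≫ [c·k]`
  have hk : Db.hat.mulN k ≫ DualPair.dualIsogenyOver (serreTranslate act E' hE' P) D Db =
      DualPair.dualIsogenyOver (serreTranslate act E' hE' P) D Db ≫ D.hat.mulN k := by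
    rw [mulN_def, mulN_def, MonObj.pow_comp, Category.id_comp, MonObj.comp_pow, Category.comp_id]
  calc serreTranslate act E' hE' P ≫ (lam' ≫ Db.hat.mulN k) ≫ DualPair.dualIsogenyOver (serreTranslate act E' hE' P) D Db
        = (serreTranslate act E' hE' P ≫ lam' ≫ DualPair.dualIsogenyOver (serreTranslate act E' hE' P) D Db) ≫ D.hat.mulN k := by
          simp only [Category.assoc, hk]
    _ = pol.lam ≫ D.hat.mulN (N ^ 2) := by
          rw [h, Category.assoc, mulN_def, mulN_def, mulN_def, MonObj.comp_pow, Category.comp_id, ← pow_mul, hck]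

end AbelianSchemeOver

end Literature.AlgebraicGeometry.AbelianSchemes

end
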